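import Literature.NumberTheory.EllipticCurves.Tian2014.CMPointSystemDescentOneSeven
import HarnessLib

/-!
# Tian 2014 Thm. 4.4 at `k = 1` (`n = p₀p₁`, `p₀ ≡ 7`, `p₁ ≡ 1 (mod 8)`) on the `n ≡ 3 (mod 4)` CM-point system, III:
# the ODD twist `m = n` — `y_n ∉ 2E(ℚ(√−n))⁻ + E[2]` (Monsky Thm. 5.14 (10), `p₁p₇` with `(p₁/p₇) = −1`) — and the
# class-group inputs `#𝒜[2] = 4`, `#(2𝒜 ∩ 𝒜[2]) = 2` as KERNEL THEOREMS (Gauss, Rédei–Reichardt), for both twists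

Cell `bsd-monsky` (prover-A seat, g15; `run/shared/lean/pub/bsd-monsky/`). HONEST FRAMING (README §1): nothing is asserted
about BSD, nothing is booked, no `_holds`, no named fact; theorems on the data `D : CMPointData n` of `CMPointSystemDisplays.lean`
with the printed properties as hypotheses. NOTHING NEW ON PAPER: Tian's Thm. 4.4 at `k = 1`, the odd twist `m = n`, by Tian's
`β`-argument (`CMPointSystemDescentOneSeven.lean` did the even twist), and the discharge of the two class-group cardinalities
on the family `n = p₀p₁`, `p₀ ≡ 7`, `p₁ ≡ 1 (mod 8)`, `(p₁/p₀) = −1` (Tian's Lemma 5.1 at `k = 1`: the graph on `{p₀, p₁}` has one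
edge, hence condition (1.1); Gauss's `#𝒜[2] = 2^{t−1}`, `t = 3`).

## Source (verbatim, arXiv:1210.8231)

* Thm. 4.4 (p0023 L4–L8) and its proof (p0025 L82–p0026 L51): see `CMPointSystemDescentOneSeven.lean`; for `m = n`:
  "(2) for each positive `d` with `p₀ | d | 2n` and `d ≠ n, 2n`, `y_d ∈ 2^k E(ℚ(√−d))⁻ + E[2]`" (here `d = 2p₀`); "`P :=
  (y₀ + (−1)^m y₀^β − Σ y′_d) ∈ E[4] ∩ E(ℚ(√2))` … `P^β + P = 0` or `(−1, 0)` … `(y′_d)^β = (−1)^m y′_d` and therefore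
  `P − (−1)^m P^β = y₀ − y₀^{β²}` … `= (1, 0)`. It is a contradiction."
* §4.2 (p0022 L66–L71): "the condition (1.1): `dim_{𝔽₂} 𝒜[4]/𝒜[2] = 1` … says that … if `p₀ ≡ 7 mod 8`, then the class of
  `ϖ′ ∈ K₂ˣ` in `𝒜` is the only non-trivial element in `𝒜[2] ∩ 2𝒜`."
* Lemma 5.1 (p. 28): "the condition (1.1) in Theorem 1.3 is equivalent to any one of the following conditions: 1. there does
  not exist a proper even partition of vertices …; 2. the graph `G` has an odd number of spanning subtrees."
* Lemma 4.8 (1) (p0025 L33–L36): "for each positive divisor `d` of `2n` congruent to `6` or `7 mod 8`, the point `y_d ∈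
  E(ℚ(√−d))⁻`" (Lemma 4.7 = Monsky Thm. 4.7; the tree's `exists_transferE_eq_yPointChi`).

## What is proved here (kernel), and from what

* §1 THE DESCENT, odd twist `m = n`, with `√−n = √−2n/√2`, `√−2p₀ = √−2n/√p₁`: `y_{n,φ} = transfer_{√−n} y″` for a rational
  `y″ ∈ E_n(ℚ)` (the tree's Monsky-Thm.-4.7 descent for signed sums, needing "complex conjugation fixes `√2`" as a further
  binder) with `y″ ∉ 2E_n(ℚ) + tor`, from `D.Printed`, the binders of the even twist, and `hDiv` on `y_{2p₀,φ}`; `β` NEGATES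
  the transfer images along `√−n` and `√−2p₀` (`ε = −1`), and `P^β + P = y₀ − y₀^{β²} = (1, 0)` is impossible.
* §2 `classGroup_seven_one`: `#𝒜[2] = 4` (Gauss, the tree's `natCard_sq_eq_one_eq`) and `#(2𝒜 ∩ 𝒜[2]) = 2` (the tree's
  `condition11_caseSeven`, Rédei–Reichardt, with the graph condition at `k = 1` from `(p₁/p₀) = −1` and quadratic reciprocity).
* §3 both twists with the class-group inputs discharged (`…_seven_one_primes`).

[cite: Tian2014, Thm. 4.4 (arXiv:1210.8231 p0023 L4–L8) and its proof (p0025 L82–p0026 L51), Lemma 4.8 (p0025 L30–L81), §4.2 (p0022 L47–L96), Lemma 5.1 (p. 28)]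
[cite: Monsky1990MockHeegner, Thm. 4.7 (pp. 57–58), Thm. 5.14 (10)/(11), Cor. 5.15 (3) (p. 66)] [cite: Cox2013, Prop. 3.11] [cite: LiMa2008, Thm. 0.4]
[cite: HeathBrown1994SelmerCongruentII, Appendix (Monsky), typescript p. 39 L13–L26]
-/

noncomputable section

open scoped Classical

open Matrix WeierstrassCurve WeierstrassCurve.Affine NumberField Literature.NumberTheory.EllipticCurves
  Literature.NumberTheory.EllipticCurves.TianYuanZhang2017 Literature.NumberTheory.EllipticCurves.HeathBrown1994
  Literature.NumberTheory.QuadraticFields.RedeiReichardt Literature.GroupTheory.FiniteAbelian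

set_option autoImplicit false

namespace Literature.NumberTheory.EllipticCurves.Tian2014

/-! ## §1 THE DESCENT, odd twist `m = n`: `y_{n,φ} ∉ 2E(ℚ(√−n))⁻ + E[2]` -/

namespace CMPointData

variable {n : ℕ} (D : CMPointData n) {θ₂ θ₁ : D.H} {p₀ p₁ : ℕ} {t₀ B : ClassGroup (𝓞 (GenusField (2 * n)))}

/-- **Tian Thm. 4.4 at `k = 1`, the ODD twist `m = n` (= Monsky Thm. 5.14 (10), `p₁p₇` with `(p₁/p₇) = −1`), the descent
step on the data**: with the binders of the even twist (`CMPointSystemDescentOneSeven.lean`) plus "complex conjugation fixes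
`√2`" (for the rationality of the signed sum `y_{n,φ}` over `ℚ(√−n)`, Lemma 4.8 (1)) and Tian's printed divisibility sentence
`hDiv : y_{2p₀,φ} ∈ 2E(ℚ(√−2p₀))⁻ + E[2]` (the consequence of Thm. 3.3 — the ONE analytic input): there is a transversal `φ` of
`𝒜/[ϖ′]` (Tian's `⋃_{[s]∈ψ}[s]φ₀`) for which `y_{n,φ}` is the transfer along `√−n = √−2n/√2` of a rational `y″ ∈ E_n(ℚ)` with
`y″ ∉ 2E_n(ℚ) + E_n(ℚ)_tor`. Proof as printed: if `y_{n,φ} = 2S + T`, (4.9) gives `2(y₀ − y₀^β − S − S′) = T + T′` so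
`P := y₀ − y₀^β − S − S′ ∈ E[4]`, fixed by `σ_{1+ϖ}`, so `2P ∈ {O, (1,0)}`; `β` negates `S`, `S′` (transfer images along
`√−n`, `√−2p₀`, both moved by `β`) so `P^β + P = y₀ − y₀^{β²} = (1, 0)` — impossible on `E[4] ∩ E(ℚ(√2))`.
[cite: Tian2014, Thm. 4.4 (p0023 L4–L8), Lemma 4.8 (p0025 L30–L81), proof of Thm. 4.4 (p0025 L82–p0026 L51)]
[cite: Monsky1990MockHeegner, Thm. 4.7 (pp. 57–58), Thm. 5.14 (10), Cor. 5.15 (3) (p. 66)] -/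
theorem exists_isReps_transferE_eq_yPointChi_not_two_smul_add_torsion_seven_one (hn : n = p₀ * p₁) (hn0 : n ≠ 0)
    (hn8 : n % 8 = 7) (hp₁ : p₁ ≠ 0) (hsqn : Squarefree n) (hP : D.Printed)
    (hθ₂ : θ₂ ^ 2 = ((2 : ℕ) : D.H)) (hθ₁ : θ₁ ^ 2 = (p₁ : D.H))
    (hτ2 : ∀ s : D.H, s ^ 2 = 2 → D.tau s = s) (hτθ₁ : D.tau θ₁ = θ₁) (hcθ₂ : D.conj θ₂ = θ₂)
    (hgen : ∀ s, (D.art s θ₂ = θ₂ ∧ D.art s θ₁ = θ₁) ↔ IsSquare s) (hπsq : IsSquare D.piPrime)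
    (hβ2 : D.art t₀ θ₂ = -θ₂) (hβ1 : D.art t₀ θ₁ = -θ₁)
    (hB2 : B * B = 1) (hBθ₂ : D.art B θ₂ = θ₂) (hBθ₁ : D.art B θ₁ = -θ₁)
    (hfour : Nat.card {c : ClassGroup (𝓞 (GenusField (2 * n))) // c ^ 2 = 1} = 4)
    (h11 : fourTwoCard (ClassGroup (𝓞 (GenusField (2 * n)))) = 2)
    (hDiv : ∀ φ : Finset (ClassGroup (𝓞 (GenusField (2 * n)))), D.IsRepsModPiPrime φ →
      ∃ (w : (congruentNumberCurve (2 * p₀)).toAffine.Point) (T' : EPoint D.H), (2 : ℕ) • T' = 0 ∧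
        D.yPointChi (D.sqrtNegTwoN / θ₁) φ =
          transferE (2 * p₀) (D.sqrtNegTwoN / θ₁) (D.div_sq_eq_neg hn hp₁ hθ₁) (D.div_ne_zero' hn0 hp₁ hθ₁)
            ((2 : ℕ) • w) + T') :
    ∃ φ : Finset (ClassGroup (𝓞 (GenusField (2 * n)))), D.IsRepsModPiPrime φ ∧
      ∃ y' : (congruentNumberCurve n).toAffine.Point,
        transferE n (D.sqrtNegTwoN / θ₂) (D.div_two_sq_eq_neg hθ₂) (D.div_two_ne_zero hn0 hθ₂) y' =
          D.yPointChi (D.sqrtNegTwoN / θ₂) φ ∧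
        ∀ z t : (congruentNumberCurve n).toAffine.Point, IsOfFinAddOrder t → y' ≠ (2 : ℤ) • z + t := by
  classical
  have hP' := hP
  obtain ⟨h1, -, h3, h48, hart, ⟨htaui, htauθ, -⟩, ⟨-, hconjθ, -⟩, -, -, hπ2, hπ1⟩ := hP'
  have hart' : ∀ s, D.art s D.sqrtNegTwoN = D.sqrtNegTwoN := fun s => (hart s).2
  have hne₂ := D.theta₂_ne_neg hθ₂
  have hne₁ := D.theta₁_ne_neg hp₁ hθ₁
  have hθ₂2 : θ₂ ^ 2 = 2 := by rw [hθ₂]; norm_num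
  -- `B ∉ {1, [ϖ′]}`
  have hB1 : B ≠ 1 := by
    intro h; rw [h, map_one, AlgEquiv.one_apply] at hBθ₁; exact hne₁ hBθ₁
  have hBπ : B ≠ D.piPrime := by
    intro h; rw [h, ((hgen _).mpr hπsq).2] at hBθ₁; exact hne₁ hBθ₁
  -- `2𝒜 ∩ 𝒜[2] = {1, [ϖ′]}` and `𝒜[2] = {1, [ϖ′], B, [ϖ′]B}`
  have h2A := eq_one_or_eq_of_isSquare_of_mul_self_eq_one_of_fourTwoCard_eq_two D.piPrime hπsq hπ2 hπ1 h11
  have hA2 := eq_one_or_eq_of_mul_self_eq_one_of_natCard_eq_four D.piPrime B hπ2 hπ1 hB2 hB1 hBπ hfour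
  have hfix2 : ∀ w, w * w = 1 → D.art w θ₂ = θ₂ := by
    intro w hw
    rcases hA2 w hw with rfl | rfl | rfl | rfl
    · rw [map_one, AlgEquiv.one_apply]
    · exact ((hgen _).mpr hπsq).1
    · exact hBθ₂
    · rw [map_mul, AlgEquiv.mul_apply, hBθ₂, ((hgen _).mpr hπsq).1]
  have htsq : IsSquare (t₀ * t₀) := ⟨t₀, rfl⟩
  have ht : ¬ ∃ r, IsSquare r ∧ t₀ * t₀ = r * r := by
    rintro ⟨r, hr, hrt⟩
    have hw : (t₀ * r⁻¹) * (t₀ * r⁻¹) = 1 := by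
      rw [mul_mul_mul_comm, hrt, mul_mul_mul_comm, mul_inv_cancel, mul_one]
    have := hfix2 _ hw
    rw [map_mul, AlgEquiv.mul_apply, ((hgen _).mpr ((isSquare_inv).mpr hr)).1, hβ2] at this
    exact hne₂ this.symm
  obtain ⟨φ₀, φ₁, m, htm, hodd, hφ₀S, hφ₀, hsum⟩ :=
    exists_special_transversal_isSquare D.piPrime hπsq h2A (t₀ * t₀) htsq ht
  have hC := D.exists_reps_isSquare hp₁ hθ₂ hθ₁ hgen hβ2 hβ1 hBθ₂ hBθ₁
  have hCu := D.reps_eq_of_isSquare hp₁ hθ₂ hθ₁ hgen hβ2 hβ1 hBθ₂ hBθ₁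
  set φ : Finset (ClassGroup (𝓞 (GenusField (2 * n)))) :=
    ((Finset.univ : Finset (Fin 4)) ×ˢ φ₀).image (fun p => reps t₀ B p.1 * p.2) with hφdef
  have hφ : D.IsRepsModPiPrime φ := isReps_image_mul_of_isReps_isSquare hπsq (reps t₀ B) hC hCu hφ₀S hφ₀
  -- rationality of `y_{n,φ}` over `ℚ(√−n)` (Lemma 4.8 (1), Monsky Thm. 4.7)
  have hπθ' : D.art D.piPrime (D.sqrtNegTwoN / θ₂) = D.sqrtNegTwoN / θ₂ := by
    rw [map_div₀, hart' _, ((hgen _).mpr hπsq).1]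
  have hτθ' : D.tau (D.sqrtNegTwoN / θ₂) = D.sqrtNegTwoN / θ₂ := by
    rw [map_div₀, htauθ, hτ2 θ₂ hθ₂2]
  have hcθ' : D.conj (D.sqrtNegTwoN / θ₂) = -(D.sqrtNegTwoN / θ₂) := by
    rw [map_div₀, hconjθ, hcθ₂, neg_div]
  obtain ⟨y', hy'⟩ := D.exists_transferE_eq_yPointChi (D.div_two_ne_zero hn0 hθ₂) hP n hn0 (D.div_two_sq_eq_neg hθ₂)
    hπθ' hτθ' hcθ' hB2 hB1 hBπ hφ
  refine ⟨φ, hφ, y', hy', ?_⟩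
  intro z t ht heq
  obtain ⟨w, T', hT'2, hyP0⟩ := hDiv φ hφ
  have ht2 : (2 : ℕ) • t = 0 := two_nsmul_eq_zero_of_isOfFinAddOrder_congruentNumberCurve hsqn ht
  set S : EPoint D.H := transferE n (D.sqrtNegTwoN / θ₂) (D.div_two_sq_eq_neg hθ₂) (D.div_two_ne_zero hn0 hθ₂) z
    with hS
  set T : EPoint D.H := transferE n (D.sqrtNegTwoN / θ₂) (D.div_two_sq_eq_neg hθ₂) (D.div_two_ne_zero hn0 hθ₂) t
    with hT
  set S' : EPoint D.H := transferE (2 * p₀) (D.sqrtNegTwoN / θ₁) (D.div_sq_eq_neg hn hp₁ hθ₁)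
    (D.div_ne_zero' hn0 hp₁ hθ₁) w with hS'
  have hyn : D.yPointChi (D.sqrtNegTwoN / θ₂) φ = (2 : ℕ) • S + T := by
    rw [← hy', heq, map_add, map_zsmul, two_zsmul, two_nsmul]
  have hyP0' : D.yPointChi (D.sqrtNegTwoN / θ₁) φ = (2 : ℕ) • S' + T' := by rw [hyP0, map_nsmul]
  have hT2 : (2 : ℕ) • T = 0 := by rw [hT, ← map_nsmul, ht2, map_zero]
  -- (4.9) at `k = 1`, odd twist
  have h49 := D.yPointChi_add_yPointChi_eq_two_nsmul_sub hp₁ hn0 hθ₂ hθ₁ hgen hβ2 hβ1 hBθ₂ hBθ₁ hφ₀S hP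
  rw [hyP0', hyn] at h49
  set y₀ : EPoint D.H := D.yPoint φ₀ with hy₀
  set A : EPoint D.H := y₀ - D.act (D.art t₀) y₀ with hA
  have h2A' : (2 : ℕ) • A = (2 : ℕ) • S + T + ((2 : ℕ) • S' + T') := by rw [hA, ← h49]; abel
  -- `σ_{1+ϖ}` fixes `A`, `S`, `S′`
  have hτA : D.act D.tau A = A := by
    rw [hA, map_sub, D.act_tau_yPoint' h1, D.act_tau_act_art_yPoint h1 h48]; abel
  have hτS : D.act D.tau S = S := by
    rw [hS]; exact act_transferE_of_fix n _ _ _ _ hτθ' z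
  have hτθ₁' : D.tau (D.sqrtNegTwoN / θ₁) = D.sqrtNegTwoN / θ₁ := by rw [map_div₀, htauθ, hτθ₁]
  have hτS' : D.act D.tau S' = S' := by
    rw [hS']; exact act_transferE_of_fix (2 * p₀) _ _ _ _ hτθ₁' w
  -- `β` negates `S`, `S′` (`ε = −1`)
  have hβθ' : D.art t₀ (D.sqrtNegTwoN / θ₂) = -(D.sqrtNegTwoN / θ₂) := by
    rw [map_div₀, hart' t₀, hβ2, div_neg]
  have hβS : D.act (D.art t₀) S = (-1 : ℤ) • S := by
    rw [neg_one_zsmul, hS]; exact act_transferE_of_neg n _ _ _ _ hβθ' z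
  have hβθ₁' : D.art t₀ (D.sqrtNegTwoN / θ₁) = -(D.sqrtNegTwoN / θ₁) := by
    rw [map_div₀, hart' t₀, hβ1, div_neg]
  have hβS' : D.act (D.art t₀) S' = (-1 : ℤ) • S' := by
    rw [neg_one_zsmul, hS']; exact act_transferE_of_neg (2 * p₀) _ _ _ _ hβθ₁' w
  -- `β(A) + A = y₀ − y₀^{β²} = (1, 0)`
  have hnegOne : -(ptOne : EPoint D.H) = ptOne := by
    rw [neg_eq_iff_add_eq_zero, ← two_nsmul]; exact two_nsmul_ptOne
  have hβA : D.act (D.art t₀) A - (-1 : ℤ) • A = ptOne := by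
    rw [neg_one_zsmul, sub_neg_eq_add, hA, map_sub, D.act_art_art_yPoint_eq_add_ptOne hn8 h3 h48 t₀ htm hodd hsum]
    rw [show D.act (D.art t₀) y₀ - (y₀ + ptOne) + (y₀ - D.act (D.art t₀) y₀) = -ptOne by abel, hnegOne]
  exact map_sub_smul_ne_ptOne D.tau (D.art t₀) D.im D.im_sq htaui hτ2
    (map_eq_neg_of_sq_eq_two (D.art t₀) hθ₂ hβ2) (Or.inr rfl) A S S' T T' h2A' hT2 hT'2 hτA hτS hτS' hβS hβS' hβA

end CMPointData

/-! ## §2 `K = ℚ(√−2p₀p₁)`, `p₀ ≡ 7`, `p₁ ≡ 1 (mod 8)`, `(p₁/p₀) = −1`: `#𝒜[2] = 4` and `#(2𝒜 ∩ 𝒜[2]) = 2` -/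

/-- **The class-group inputs of Tian's Thm. 4.4 at `k = 1`, for `K = ℚ(√−2p₀p₁)`, `p₀ ≡ 7`, `p₁ ≡ 1 (mod 8)`, `(p₁/p₀) = −1`**:
`#𝒜[2] = 4` (Gauss: `2^{t−1}`, `t = 3` ramified primes `2, p₀, p₁`; the tree's `natCard_sq_eq_one_eq`) and `#(2𝒜 ∩ 𝒜[2]) = 2`
(Tian's condition (1.1) for `p₀ ≡ 7 (8)`: "the class of `ϖ′` … is the only non-trivial element in `𝒜[2] ∩ 2𝒜`", p0022 L69–L71 —
the tree's `condition11_caseSeven` (Lemma 5.1 ⇐, Rédei–Reichardt a tree theorem) with the graph condition at `k = 1`: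
`(p₁/p₀) = −1` gives `(p₀/p₁) = −1` by quadratic reciprocity, Monsky's matrix `A = (1 1; 1 1)` has kernel `{0, (1,1)}`).
One statement (the `p₀ ≡ 3`, `5 (mod 8)` twins are `classGroup_three_one` and `CMPointDataOne.*_two_primes`).
[cite: Tian2014, §4.2 (p0022 L66–L76), Lemma 5.1 (p. 28)] [cite: LiMa2008, Thm. 0.4] [cite: Cox2013, Prop. 3.11]
[cite: HeathBrown1994SelmerCongruentII, Appendix (Monsky), typescript p. 39 L13–L26] -/
theorem classGroup_seven_one {p₀ p₁ : ℕ} (hp₀ : p₀.Prime) (hp₁ : p₁.Prime) (h₀7 : p₀ % 8 = 7) (h₁1 : p₁ % 8 = 1)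
    (hj : jacobiSym (p₁ : ℤ) p₀ = -1) :
    Nat.card {c : ClassGroup (𝓞 (GenusField (2 * (p₀ * p₁)))) // c ^ 2 = 1} = 4 ∧
    fourTwoCard (ClassGroup (𝓞 (GenusField (2 * (p₀ * p₁))))) = 2 := by
  have hne : p₀ ≠ p₁ := by omega
  have hp₀2 : p₀ ≠ 2 := by omega
  have hp₁2 : p₁ ≠ 2 := by omega
  have hd1 : 1 ≤ 2 * (p₀ * p₁) := by have := hp₀.two_le; have := hp₁.two_le; nlinarith
  -- Gauss: `#𝒜[2] = 4`
  have hgauss : Nat.card {c : ClassGroup (𝓞 (GenusField (2 * (p₀ * p₁)))) // c ^ 2 = 1} = 4 := by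
    obtain ⟨x, -, hx⟩ := exists_ringOfIntegers_sq_eq_neg (K := GenusField (2 * (p₀ * p₁))) (root_genusField_sq hd1)
    have hq : ∀ i, ((![2, p₀, p₁] : Fin 3 → ℕ) i).Prime := by
      intro i; fin_cases i
      · exact Nat.prime_two
      · exact hp₀
      · exact hp₁
    have hinj : Function.Injective (![2, p₀, p₁] : Fin 3 → ℕ) := by
      intro i j hij
      fin_cases i <;> fin_cases j <;> simp_all
    have hprod : ∏ i, (![2, p₀, p₁] : Fin 3 → ℕ) i =
        if (2 * (p₀ * p₁)) % 4 = 1 then 2 * (2 * (p₀ * p₁)) else 2 * (p₀ * p₁) := by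
      rw [if_neg (by omega), Fin.prod_univ_three]
      simp [mul_assoc]
    have := natCard_sq_eq_one_eq (finrank_genusField (2 * (p₀ * p₁))) hx hq hinj hprod
    simpa using this
  -- the graph condition at `k = 1`
  have hG : ∀ v : Fin 2 → ZMod 2, legendreMatrix ![p₀, p₁] *ᵥ v = 0 → v = 0 ∨ v = fun _ => 1 := by
    have hj' : jacobiSym (p₀ : ℤ) p₁ = -1 := by
      have h := jacobiSym.quadratic_reciprocity_one_mod_four (a := p₁) (b := p₀) (by omega)
        (Nat.odd_iff.mpr (by omega))
      rw [← h]; exact hj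
    have ha10 : addLegendreSym (p₁ : ℤ) p₀ = 1 := addLegendreSym_of_eq_neg_one hj
    have ha01 : addLegendreSym (p₀ : ℤ) p₁ = 1 := addLegendreSym_of_eq_neg_one hj'
    have hM : ∀ i j : Fin 2, legendreMatrix ![p₀, p₁] i j = 1 := by
      intro i j
      fin_cases i <;> fin_cases j <;>
        simp [legendreMatrix, Finset.sum_erase_eq_sub, Fin.sum_univ_two, ha10, ha01]
    intro v hv
    have h0 := congr_fun hv 0
    simp only [Matrix.mulVec, dotProduct, Fin.sum_univ_two, hM, one_mul, Pi.zero_apply] at h0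
    have hv01 : v 1 = v 0 := by
      have h2 : ∀ a b : ZMod 2, a + b = 0 → b = a := by decide
      exact h2 _ _ h0
    rcases (by decide : ∀ a : ZMod 2, a = 0 ∨ a = 1) (v 0) with h | h
    · left; funext i; revert i; rw [Fin.forall_fin_two]
      exact ⟨h, by rw [hv01]; exact h⟩
    · right; funext i; revert i; rw [Fin.forall_fin_two]
      exact ⟨h, by rw [hv01]; exact h⟩
  -- Tian's (1.1) at `k = 1`: `#(2𝒜 ∩ 𝒜[2]) = 2`
  have h11 : fourTwoCard (ClassGroup (𝓞 (GenusField (2 * (p₀ * p₁))))) = 2 := by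
    have hq : ∀ i, ((![p₀, p₁] : Fin 2 → ℕ) i).Prime := by
      intro i; fin_cases i
      · exact hp₀
      · exact hp₁
    have hinj : Function.Injective (![p₀, p₁] : Fin 2 → ℕ) := by
      intro i j hij
      fin_cases i <;> fin_cases j <;> simp_all
    have h70 : (![p₀, p₁] : Fin 2 → ℕ) 0 % 8 = 7 := h₀7
    have h1 : ∀ i : Fin 2, i ≠ 0 → (![p₀, p₁] : Fin 2 → ℕ) i % 8 = 1 := by
      intro i hi; fin_cases i
      · exact absurd rfl hi
      · exact h₁1
    have hn : ∏ i, (![p₀, p₁] : Fin 2 → ℕ) i = p₀ * p₁ := by simp [Fin.prod_univ_two]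
    have hK : IsQuadraticFieldOfSqrt (GenusField (2 * (p₀ * p₁))) (-(2 * (p₀ * p₁) : ℤ)) := by
      have h := isQuadraticFieldOfSqrt_genusField (d := 2 * (p₀ * p₁)) hd1
      have hc : (-((2 * (p₀ * p₁) : ℕ) : ℤ)) = -(2 * (p₀ * p₁) : ℤ) := by push_cast; ring
      rwa [hc] at h
    have hc11 := condition11_caseSeven ![p₀, p₁] redeiReichardt_fourTwoCard_classGroup_holds hq hinj h70 h1 hG hn
      (GenusField (2 * (p₀ * p₁))) hK
    unfold Condition11 at hc11
    have hmod : (p₀ * p₁) % 8 = 7 := by rw [Nat.mul_mod, h₀7, h₁1]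
    rw [if_neg (by omega)] at hc11
    exact hc11
  exact ⟨hgauss, h11⟩

/-! ## §3 Both twists with the class-group inputs discharged -/

namespace CMPointData

variable {n : ℕ} (D : CMPointData n) {θ₂ θ₁ : D.H} {p₀ p₁ : ℕ} {t₀ B : ClassGroup (𝓞 (GenusField (2 * n)))}

/-- `2n` and `n` are square-free for `n = p₀p₁` a product of two distinct odd primes. [cite: Tian2014, Thm. 4.4 (p0023 L4–L5: "a product of distinct primes")] [folklore] -/
theorem squarefree_two_mul_of_primes (hn : n = p₀ * p₁) (hp₀ : p₀.Prime) (hp₁ : p₁.Prime) (h₀7 : p₀ % 8 = 7)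
    (h₁1 : p₁ % 8 = 1) : Squarefree (2 * n) ∧ Squarefree n := by
  have hsqn : Squarefree n := by
    rw [hn]
    exact (Nat.squarefree_mul ((Nat.coprime_primes hp₀ hp₁).mpr (by omega))).mpr
      ⟨hp₀.prime.squarefree, hp₁.prime.squarefree⟩
  refine ⟨?_, hsqn⟩
  have hcop : Nat.Coprime 2 n := by
    rw [hn]
    exact Nat.Coprime.mul_right ((Nat.coprime_primes Nat.prime_two hp₀).mpr (by omega))
      ((Nat.coprime_primes Nat.prime_two hp₁).mpr (by omega))
  exact (Nat.squarefree_mul hcop).mpr ⟨Nat.prime_two.prime.squarefree, hsqn⟩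

omit D in
/-- `n = p₀p₁ ≡ 7 (mod 8)` for `p₀ ≡ 7`, `p₁ ≡ 1 (mod 8)`. [cite: Tian2014, Thm. 2.8 (3) (p0011 L42–L44: the case n ≡ 7 mod 8)] [folklore] -/
theorem mod_eight_eq_seven (hn : n = p₀ * p₁) (h₀7 : p₀ % 8 = 7) (h₁1 : p₁ % 8 = 1) : n % 8 = 7 := by
  rw [hn, Nat.mul_mod, h₀7, h₁1]

/-- **Tian Thm. 4.4 at `k = 1`, EVEN twist, for `n = p₀p₁`, `p₀ ≡ 7`, `p₁ ≡ 1 (mod 8)` primes with `(p₁/p₀) = −1`** (Monsky's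
Cor. 5.15 (3) «`2p₁p₇` when `(p₁/p₇) = −1`», Thm. 5.14 (11)): the kernel inputs `#𝒜[2] = 4` and `#(2𝒜 ∩ 𝒜[2]) = 2` discharged.
[cite: Tian2014, Thm. 4.4 (p0023 L4–L8), Lemma 5.1 (p. 28)] [cite: Monsky1990MockHeegner, Thm. 5.14 (11), Cor. 5.15 (3) (p. 66)] -/
theorem exists_isReps_transfer_eq_yPoint_not_two_smul_add_torsion_seven_one_primes (hn : n = p₀ * p₁)
    (hp₀ : p₀.Prime) (hp₁ : p₁.Prime) (h₀7 : p₀ % 8 = 7) (h₁1 : p₁ % 8 = 1) (hj : jacobiSym (p₁ : ℤ) p₀ = -1)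
    (hP : D.Printed) (hθ₂ : θ₂ ^ 2 = ((2 : ℕ) : D.H)) (hθ₁ : θ₁ ^ 2 = (p₁ : D.H))
    (hτ2 : ∀ s : D.H, s ^ 2 = 2 → D.tau s = s) (hτθ₁ : D.tau θ₁ = θ₁)
    (hgen : ∀ s, (D.art s θ₂ = θ₂ ∧ D.art s θ₁ = θ₁) ↔ IsSquare s) (hπsq : IsSquare D.piPrime)
    (hβ2 : D.art t₀ θ₂ = -θ₂) (hβ1 : D.art t₀ θ₁ = -θ₁)
    (hB2 : B * B = 1) (hBθ₂ : D.art B θ₂ = θ₂) (hBθ₁ : D.art B θ₁ = -θ₁)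
    (hDiv : ∀ φ : Finset (ClassGroup (𝓞 (GenusField (2 * n)))), D.IsRepsModPiPrime φ →
      ∃ (w : (congruentNumberCurve p₀).toAffine.Point) (T' : EPoint D.H), (2 : ℕ) • T' = 0 ∧
        D.yPointChi (D.sqrtNegTwoN / (θ₂ * θ₁)) φ =
          transferE p₀ (D.sqrtNegTwoN / (θ₂ * θ₁)) (D.div_mul_sq_eq_neg hn hp₁.ne_zero hθ₂ hθ₁)
            (D.div_mul_ne_zero (by rw [hn]; exact Nat.mul_ne_zero hp₀.ne_zero hp₁.ne_zero) hp₁.ne_zero hθ₂ hθ₁)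
            ((2 : ℕ) • w) + T') :
    ∃ φ : Finset (ClassGroup (𝓞 (GenusField (2 * n)))), D.IsRepsModPiPrime φ ∧
      ∃ y' : (congruentNumberCurve (2 * n)).toAffine.Point,
        D.transfer (by rw [hn]; exact Nat.mul_ne_zero hp₀.ne_zero hp₁.ne_zero) y' = D.yPoint φ ∧
        ∀ z t : (congruentNumberCurve (2 * n)).toAffine.Point, IsOfFinAddOrder t → y' ≠ (2 : ℤ) • z + t := by
  have hn0 : n ≠ 0 := by rw [hn]; exact Nat.mul_ne_zero hp₀.ne_zero hp₁.ne_zero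
  have hfour : Nat.card {c : ClassGroup (𝓞 (GenusField (2 * n))) // c ^ 2 = 1} = 4 := by
    subst hn; exact (classGroup_seven_one hp₀ hp₁ h₀7 h₁1 hj).1
  have h11 : fourTwoCard (ClassGroup (𝓞 (GenusField (2 * n)))) = 2 := by
    subst hn; exact (classGroup_seven_one hp₀ hp₁ h₀7 h₁1 hj).2
  exact D.exists_isReps_transfer_eq_yPoint_not_two_smul_add_torsion_seven_one hn hn0
    (mod_eight_eq_seven hn h₀7 h₁1) hp₁.ne_zero (squarefree_two_mul_of_primes hn hp₀ hp₁ h₀7 h₁1).1 hP hθ₂ hθ₁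
    hτ2 hτθ₁ hgen hπsq hβ2 hβ1 hB2 hBθ₂ hBθ₁ hfour h11 hDiv

/-- **Tian Thm. 4.4 at `k = 1`, ODD twist, for `n = p₀p₁`, `p₀ ≡ 7`, `p₁ ≡ 1 (mod 8)` primes with `(p₁/p₀) = −1`** (Monsky's
Cor. 5.15 (3) «`p₁p₇` when `(p₁/p₇) = −1`», Thm. 5.14 (10)): the kernel inputs `#𝒜[2] = 4` and `#(2𝒜 ∩ 𝒜[2]) = 2` discharged.
[cite: Tian2014, Thm. 4.4 (p0023 L4–L8), Lemma 5.1 (p. 28)] [cite: Monsky1990MockHeegner, Thm. 5.14 (10), Cor. 5.15 (3) (p. 66)] -/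
theorem exists_isReps_transferE_eq_yPointChi_not_two_smul_add_torsion_seven_one_primes (hn : n = p₀ * p₁)
    (hp₀ : p₀.Prime) (hp₁ : p₁.Prime) (h₀7 : p₀ % 8 = 7) (h₁1 : p₁ % 8 = 1) (hj : jacobiSym (p₁ : ℤ) p₀ = -1)
    (hP : D.Printed) (hθ₂ : θ₂ ^ 2 = ((2 : ℕ) : D.H)) (hθ₁ : θ₁ ^ 2 = (p₁ : D.H))
    (hτ2 : ∀ s : D.H, s ^ 2 = 2 → D.tau s = s) (hτθ₁ : D.tau θ₁ = θ₁) (hcθ₂ : D.conj θ₂ = θ₂)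
    (hgen : ∀ s, (D.art s θ₂ = θ₂ ∧ D.art s θ₁ = θ₁) ↔ IsSquare s) (hπsq : IsSquare D.piPrime)
    (hβ2 : D.art t₀ θ₂ = -θ₂) (hβ1 : D.art t₀ θ₁ = -θ₁)
    (hB2 : B * B = 1) (hBθ₂ : D.art B θ₂ = θ₂) (hBθ₁ : D.art B θ₁ = -θ₁)
    (hDiv : ∀ φ : Finset (ClassGroup (𝓞 (GenusField (2 * n)))), D.IsRepsModPiPrime φ →
      ∃ (w : (congruentNumberCurve (2 * p₀)).toAffine.Point) (T' : EPoint D.H), (2 : ℕ) • T' = 0 ∧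
        D.yPointChi (D.sqrtNegTwoN / θ₁) φ =
          transferE (2 * p₀) (D.sqrtNegTwoN / θ₁) (D.div_sq_eq_neg hn hp₁.ne_zero hθ₁)
            (D.div_ne_zero' (by rw [hn]; exact Nat.mul_ne_zero hp₀.ne_zero hp₁.ne_zero) hp₁.ne_zero hθ₁)
            ((2 : ℕ) • w) + T') :
    ∃ φ : Finset (ClassGroup (𝓞 (GenusField (2 * n)))), D.IsRepsModPiPrime φ ∧
      ∃ y' : (congruentNumberCurve n).toAffine.Point,
        transferE n (D.sqrtNegTwoN / θ₂) (D.div_two_sq_eq_neg hθ₂)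
          (D.div_two_ne_zero (by rw [hn]; exact Nat.mul_ne_zero hp₀.ne_zero hp₁.ne_zero) hθ₂) y' =
          D.yPointChi (D.sqrtNegTwoN / θ₂) φ ∧
        ∀ z t : (congruentNumberCurve n).toAffine.Point, IsOfFinAddOrder t → y' ≠ (2 : ℤ) • z + t := by
  have hn0 : n ≠ 0 := by rw [hn]; exact Nat.mul_ne_zero hp₀.ne_zero hp₁.ne_zero
  have hfour : Nat.card {c : ClassGroup (𝓞 (GenusField (2 * n))) // c ^ 2 = 1} = 4 := by
    subst hn; exact (classGroup_seven_one hp₀ hp₁ h₀7 h₁1 hj).1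
  have h11 : fourTwoCard (ClassGroup (𝓞 (GenusField (2 * n)))) = 2 := by
    subst hn; exact (classGroup_seven_one hp₀ hp₁ h₀7 h₁1 hj).2
  exact D.exists_isReps_transferE_eq_yPointChi_not_two_smul_add_torsion_seven_one hn hn0
    (mod_eight_eq_seven hn h₀7 h₁1) hp₁.ne_zero (squarefree_two_mul_of_primes hn hp₀ hp₁ h₀7 h₁1).2 hP hθ₂ hθ₁
    hτ2 hτθ₁ hcθ₂ hgen hπsq hβ2 hβ1 hB2 hBθ₂ hBθ₁ hfour h11 hDiv

end CMPointData

end Literature.NumberTheory.EllipticCurves.Tian2014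

end
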